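import Summits.MatrixMultiplication.OmegaCensus.SmallFormats.MatMul22nRankGF7Slack4Search
import HarnessLib

/-!
# ω-census family (a): slack-4 search certificate replay, classes 0–30 (part 1 of 3)

Cell `pub-omega` (unit `pub-omega-tensor-g15`), topic `Summits/MatrixMultiplication/OmegaCensus` (sub-folder `SmallFormats`).
Framing (verbatim): lottery ticket; floor = certified bounds/negative ranges. HONEST FRAMING: kernel replays of the slack-4 search certificate
(`MatMul22nRankGF7Slack4Search`; generated by `pub-omega-tensor-g15/code/gen_runfiles.py`); meaning only through
`MatMul22nRankGF7Slack4SearchSound2.search7_sound`. Nothing here is progress on `ω`.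
-/

namespace Summit.MatrixMultiplication.OmegaCensus.SmallFormats

set_option maxRecDepth 100000 in
set_option maxHeartbeats 40000000 in
/-- `search7 c` for `0 ≤ c < 3` (2377 search nodes). -/
theorem search7_ok_1_1 : ∀ c : Fin 120, 0 ≤ c.val → c.val < 3 → search7 c.val = true := by decide +kernel

set_option maxRecDepth 100000 in
set_option maxHeartbeats 40000000 in
/-- `search7 c` for `3 ≤ c < 10` (3030 search nodes). -/
theorem search7_ok_1_2 : ∀ c : Fin 120, 3 ≤ c.val → c.val < 10 → search7 c.val = true := by decide +kernel

set_option maxRecDepth 100000 in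
set_option maxHeartbeats 40000000 in
/-- `search7 c` for `10 ≤ c < 19` (2725 search nodes). -/
theorem search7_ok_1_3 : ∀ c : Fin 120, 10 ≤ c.val → c.val < 19 → search7 c.val = true := by decide +kernel

set_option maxRecDepth 100000 in
set_option maxHeartbeats 40000000 in
/-- `search7 c` for `19 ≤ c < 31` (2011 search nodes). -/
theorem search7_ok_1_4 : ∀ c : Fin 120, 19 ≤ c.val → c.val < 31 → search7 c.val = true := by decide +kernel

/-- `search7 c` for `0 ≤ c < 31`. -/
theorem search7_ok_1 {c : ℕ} (h1 : 0 ≤ c) (h2 : c < 31) : search7 c = true := by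
  by_cases hb1 : c < 3
  · exact search7_ok_1_1 ⟨c, by omega⟩ (by show 0 ≤ c; omega) hb1
  by_cases hb2 : c < 10
  · exact search7_ok_1_2 ⟨c, by omega⟩ (by show 3 ≤ c; omega) hb2
  by_cases hb3 : c < 19
  · exact search7_ok_1_3 ⟨c, by omega⟩ (by show 10 ≤ c; omega) hb3
  exact search7_ok_1_4 ⟨c, by omega⟩ (by show 19 ≤ c; omega) (by show c < 31; omega)

end Summit.MatrixMultiplication.OmegaCensus.SmallFormats
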